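import Summits.Ventures.HodgeRepro2.T6A3Pairing
import Summits.Ventures.HodgeRepro2.BridgeDual

/-!
# T6-A3 — Theorem A (TIER4 §A6) assembled over explicit carriers

Tier 6 (README §10), sub-goal A3, seat t6-p3; proof lane.  The two remaining steps of
route/TIER4.md §A3 after `T6A3Pairing`:
* Lemma A7.2 (the rational form of (N)): the ℂ-linear functional `u ↦ ⟨y, θ^8 ∪ u⟩` on
  `H^*(B, ℂ)` is non-zero at some Weil vector `w_σ`, hence non-zero at some RATIONAL `w ∈ W_F(B)`
  (the `w_σ` lie in the ℂ-span of `W_F(B)`, Prop. A2.3(iv)) — `exists_rational_pair_ne_zero`;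
* §A6, the assembly: `y` algebraic and `∃ w ∈ W_F(B), ⟨y, θ^8 ∪ w⟩ ≠ 0` give `W_F(B) ⊆ Alg^4(B)` by
  LINE-HIT — p4's accepted `BridgeDual.CohomBridgeData.weil_le_alg_of_pair_lefschetz_ne_zero`
  (p387446), whose `CohomBridgeData` bundles `Alg`, `W_F(B)`, the projector `p_W`, the Poincaré
  pairing and `L^8 = θ^8 ∪ −` over the correspondence ring `R` (A1's §A2–§A3).
The rational carriers `V = H^4(B, ℚ)`, `V' = H^20(B, ℚ)` are compared with the complex carrier
`H = H^*(B, ℂ)` through a map `ιV : V → H` (the coefficient extension), with the two compatibility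
facts stated as hypotheses: the pairing `⟨yℚ, L^8 w⟩` computes `∫_B y ∪ θ^8 ∪ ιV w`, and every `w_σ`
lies in `span_ℂ (ιV '' W_F(B))`.  Everything here is carrier-free glue; `T6A3Main.lean` instantiates
it on `T6Interface.HodgeTheory` (TARGET-T6.md §2 Layer II).
-/

namespace Summit.Ventures.HodgeRepro2.T6.A3TheoremA

open WeilPlanes WeilIntegral WeilDetect WeilCoproduct WeilPairing A3Pairing BridgeDual

variable {ι : Type*} [DecidableEq ι] [Fintype ι]
variable {H : Type*} [Ring H] [Algebra ℂ H]
variable {HH : Type*} [Ring HH] [Algebra ℂ HH]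
variable {HS : Type*} [Ring HS] [Algebra ℂ HS]
variable {R : Type*} [CommRing R]
variable {V : Type*} [AddCommGroup V] [Module R V]
variable {V' : Type*} [AddCommGroup V'] [Module R V']

section Descent

/-- The functional `u ↦ ∫_B (a ∪ u)` on `H^*(B, ℂ)` (ℂ-linear). -/
noncomputable def pairWith (intB : H →ₗ[ℂ] ℂ) (a : H) : H →ₗ[ℂ] ℂ :=
  intB ∘ₗ LinearMap.mulLeft ℂ a

/-- `pairWith intB a u = ∫_B (a ∪ u)`. -/
theorem pairWith_apply (intB : H →ₗ[ℂ] ℂ) (a u : H) : pairWith intB a u = intB (a * u) := rfl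

/-- **Lemma A7.2 (descent to the rational Weil space).**  If the functional `u ↦ ∫_B (a ∪ u)`
vanishes on the image `ιV '' W` of a rational subspace, it vanishes on every vector of the ℂ-span
of that image; contrapositively, a non-zero value at a vector of the span forces a non-zero value
at some `ιV w`, `w ∈ W`. -/
theorem exists_mem_pair_ne_zero_of_mem_span (intB : H →ₗ[ℂ] ℂ) (a : H) (ιV : V → H)
    (W : Submodule R V) {x : H} (hx : x ∈ Submodule.span ℂ (ιV '' (W : Set V)))
    (hne : intB (a * x) ≠ 0) : ∃ w ∈ W, intB (a * ιV w) ≠ 0 := by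
  by_contra hcon
  have hle : Submodule.span ℂ (ιV '' (W : Set V)) ≤ LinearMap.ker (pairWith intB a) := by
    rw [Submodule.span_le]
    rintro _ ⟨w, hw, rfl⟩
    rw [SetLike.mem_coe, LinearMap.mem_ker, pairWith_apply]
    by_contra h
    exact hcon ⟨w, hw, h⟩
  exact hne (hle hx)

end Descent

section TheoremA

variable (Φ : A ι ≃ₐ[ℂ] H) (ℬ : ℕ → Submodule ℂ HH) (pr₁ pr₂ mStar : H →ₐ[ℂ] HH)
  (intB : H →ₗ[ℂ] ℂ) (intBB : HH →ₗ[ℂ] ℂ) (intS : HS →ₗ[ℂ] ℂ) (fStar : H →ₐ[ℂ] HS)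
  (z : H) (c : ι → ℂ) (volB : ℂ)

/-- **Theorem A (TIER4 §A6), the A3 assembly over explicit carriers.**  Hypotheses, in the order
of the prose: the A1 bridge data `D` (`Alg`, `W_F(B)`, `p_W`, the Poincaré pairing, `L^8`) with
`W_F(B)` a simple `R`-module (A3.1); the rational class `yℚ ∈ Alg^4(B)` (A4.3) whose complex
image is `y = ιV yℚ`; the comparison `⟨yℚ, L^8 w⟩ = ∫_B y ∪ θ^8 ∪ ιV w` on `W_F(B)`; the Weil
vectors `w_σ = Φ (weil P₀ s)` of the six embeddings (`|P₀| = 4`, twelve planes) all in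
`span_ℂ (ιV '' W_F(B))` (Prop. A2.3(iv)); the (A5.0)–(A5.2) facts consumed by the pairing identity
(`T6A3Pairing`); the coefficients `c_p ≠ 0` (A4.2); and THE PERIOD INPUT (N):
`∃ σ ∈ Σ, ∫_S f₁^* e_{1,σ} ∧ f₂^* e_{2,σ} ∧ f₃^* e_{3,σ} ∧ f₄^* e_{4,σ} ≠ 0`.  Conclusion: every
split Weil class of `B` is algebraic, `W_F(B) ≤ Alg^4(B)`. -/
theorem weil_le_alg_of_periodInput (D : CohomBridgeData R V V') [IsSimpleModule R D.weil]
    (ιV : V → H) (yℚ : V) (hyalg : yℚ ∈ D.alg)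
    (hcompat : ∀ w ∈ D.weil,
      ((D.pair yℚ (D.lefschetz w) : ℚ) : ℂ) = intB (ιV yℚ * (Φ (theta c) ^ 8 * ιV w)))
    (embeddings : Finset (Finset ι × Bool)) (hemb : ∀ σ ∈ embeddings, σ.1.card = 4)
    (hι : Fintype.card ι = 12)
    (hspan : ∀ σ ∈ embeddings, Φ (weil σ.1 σ.2) ∈ Submodule.span ℂ (ιV '' (D.weil : Set V)))
    (hGC : GradedCommutative ℬ) (h₁ : PullbackGraded Φ ℬ pr₁) (h₂ : PullbackGraded Φ ℬ pr₂)
    (hcop : CoproductDegreeOne Φ pr₁ pr₂ mStar) (hF : FubiniProduct intB intBB pr₁ pr₂)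
    (hvol : IntegralModel Φ intB volB)
    (hy : PontryaginPairing Φ intB intBB pr₁ pr₂ mStar z (ιV yℚ) c)
    (hz : GysinPullback intB intS fStar z) (hc : ∀ p, c p ≠ 0)
    (hN : ∃ σ ∈ embeddings, intS (periodForm Φ fStar σ) ≠ 0) :
    D.weil ≤ D.alg := by
  obtain ⟨σ, hσ, hNσ⟩ := hN
  rw [periodForm_eq] at hNσ
  -- the pairing of y with θ^8 ∪ w_σ is non-zero (T6A3Pairing)
  have hne := pair_ne_zero_of_period_ne_zero Φ ℬ pr₁ pr₂ mStar intB intBB intS fStar z (ιV yℚ) c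
    volB hGC h₁ h₂ hcop hF hvol hy hz hc σ.1 σ.2 (hemb σ hσ) hNσ
  have h8 : (Finset.univ \ σ.1).card = 8 := by
    rw [Finset.card_sdiff_of_subset (Finset.subset_univ _), Finset.card_univ, hι, hemb σ hσ]
  rw [h8, map_mul Φ, map_pow Φ, ← mul_assoc] at hne
  -- descend to a rational w ∈ W_F(B) (Lemma A7.2)
  obtain ⟨w, hw, hwne⟩ :=
    exists_mem_pair_ne_zero_of_mem_span intB (ιV yℚ * Φ (theta c) ^ 8) ιV D.weil (hspan σ hσ) hne
  -- LINE-HIT (p4's BridgeDual, A6)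
  refine D.weil_le_alg_of_pair_lefschetz_ne_zero hyalg ⟨w, hw, ?_⟩
  intro h0
  apply hwne
  rw [mul_assoc, ← hcompat w hw, h0, Rat.cast_zero]

end TheoremA

end Summit.Ventures.HodgeRepro2.T6.A3TheoremA
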